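import Mathlib
import HarnessLib
import Literature.Computability.AlgebraicComplexity.TensorInvariantSeparation
import Literature.Computability.AlgebraicComplexity.QuantumFunctionalsSemiInvariant
import Literature.Computability.AlgebraicComplexity.QuantumFunctionalsDegenerationProofs

/-!
# OutsiderSandwich — POLYSTABLE RIGIDITY: a degeneration between critical tensors is an isomorphism

Route `OutsiderSandwich` (decomp-mm lens 4 «minimal counterexample / extremal reduction», gen 32);
route-independent instrument (no `Theses` import), used by
`OutsiderSandwichNoPerfectDegeneration` on the cells of the `cw₂`-tower.

## The instrument (Kempf–Ness rigidity of closed orbits)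

`exists_smul_sl3_eq_of_degeneratesTo`: if `w₀ ⊵ w₁` (`TensorDegeneratesTo`: `w₁` lies in the
Euclidean closure of `GL³·w₀`), both `w₀` and `w₁` are POLYSTABLE (closed `SL³`-orbits, BI 2017
§4.2, tree `IsPolystableTensor`) and `w₁ ≠ 0`, then `w₁ = c • (s·w₀)` for a scalar `c ≠ 0` and some
`s ∈ SL³` — the degeneration is an ISOMORPHISM (`restrictsTo_and_of_degeneratesTo`: restriction
both ways; `not_degeneratesTo_of_polystable`).

Proof (elementary; the invariant theory is the tree's): write the approximating sequence
`g_k·w₀ → w₁` as `c_k • (s_k·w₀)` with `s_k ∈ SL³` (`GL = ℂˣ·SL` over `ℂ`: `exists_eq_smul_sl`,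
roots of the determinant); the closed orbit `SL³·w₀ ∌ 0` stays a positive distance from `0`, so
`(c_k)` is bounded; along a convergent subsequence `c_k → a`: `a = 0` is excluded by an
`SL³`-invariant polynomial `q` with `q(w₁) = 1`, `q(0) = 0` (tree
`IsPolystableTensor.exists_isSL3Invariant_eq_one_of_forall_eq_zero`; `q(g_k·w₀) = q(c_k • w₀) → q(0)`),
and `a ≠ 0` puts `a⁻¹ • w₁ = lim s_k·w₀` in the CLOSED orbit `SL³·w₀`.

## References

* G. Kempf, L. Ness, *The length of vectors in representation spaces*, in: Algebraic Geometry
  (Copenhagen 1978), LNM 732, Springer (1979), 233–243, Thm. 0.2. [KempfNess1979]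
* P. Bürgisser, C. Ikenmeyer, *Fundamental invariants of orbit closures*, J. Algebra 477 (2017),
  390–434, §4.2 and §5. [BurgisserIkenmeyer2017]
* M. Christandl, P. Vrana, J. Zuiddam, *Universal points in the asymptotic spectrum of tensors*,
  J. Amer. Math. Soc. 36 (2023), Rem. 1.2. [ChristandlVranaZuiddam2023]
-/

noncomputable section

open Filter Topology
open Literature.Computability.AlgebraicComplexity

namespace Summit.MatrixMultiplication.MatrixMultiplication.Theorems.OutsiderSandwichPolystableRigidity

/-! ## The action: scalars, `GL = ℂˣ · SL`, inverses -/

section Action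

variable {ι : Type*} [Fintype ι] [DecidableEq ι]

omit [DecidableEq ι] in
/-- `(A ⊗ B ⊗ C)·(c • t) = c • (A ⊗ B ⊗ C)·t`. [folklore] -/
theorem actTensor_smul_arg {κ μ ι' κ' μ' : Type*} [Fintype κ] [Fintype μ]
    (A : Matrix ι' ι ℂ) (B : Matrix κ' κ ℂ) (C : Matrix μ' μ ℂ) (c : ℂ) (t : ι → κ → μ → ℂ) :
    actTensor A B C (c • t) = c • actTensor A B C t := by
  funext x y z
  simp only [actTensor_apply, Pi.smul_apply, smul_eq_mul, Finset.mul_sum]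
  exact Finset.sum_congr rfl fun _ _ => Finset.sum_congr rfl fun _ _ =>
    Finset.sum_congr rfl fun _ _ => by ring

/-- `s⁻¹ s = 1` for `s ∈ SL`. [folklore] -/
theorem sl_inv_mul (u : Matrix.SpecialLinearGroup ι ℂ) :
    (u : Matrix ι ι ℂ)⁻¹ * (u : Matrix ι ι ℂ) = 1 :=
  Matrix.nonsing_inv_mul _ (by rw [Matrix.SpecialLinearGroup.det_coe]; exact isUnit_one)

/-- Over `ℂ`, `GL = ℂˣ · SL`: every invertible matrix is a nonzero scalar times a matrix of
determinant one (take an `n`-th root of the determinant). [folklore] -/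
theorem exists_eq_smul_sl [Nonempty ι] (g : GL ι ℂ) :
    ∃ (c : ℂ) (s : Matrix.SpecialLinearGroup ι ℂ), c ≠ 0 ∧
      (g : Matrix ι ι ℂ) = c • (s : Matrix ι ι ℂ) := by
  have hn : 0 < Fintype.card ι := Fintype.card_pos
  have hdet : (g : Matrix ι ι ℂ).det ≠ 0 :=
    ((Matrix.isUnit_iff_isUnit_det _).mp g.isUnit).ne_zero
  obtain ⟨α, hα⟩ := IsAlgClosed.exists_pow_nat_eq (g : Matrix ι ι ℂ).det hn
  have hα0 : α ≠ 0 := by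
    rintro rfl
    rw [zero_pow hn.ne'] at hα
    exact hdet hα.symm
  refine ⟨α, ⟨α⁻¹ • (g : Matrix ι ι ℂ), ?_⟩, hα0, ?_⟩
  · rw [Matrix.det_smul, inv_pow, hα, inv_mul_cancel₀ hdet]
  · show (g : Matrix ι ι ℂ) = α • (α⁻¹ • (g : Matrix ι ι ℂ))
    rw [smul_smul, mul_inv_cancel₀ hα0, one_smul]

/-- `GL³ = ℂˣ · SL³` on tensors: `g·w = c • (s·w)` with `s ∈ SL³`, `c ≠ 0`, uniformly in `w`.
[folklore] -/
theorem exists_eq_smul_sl3 [Nonempty ι] (g : GL ι ℂ × GL ι ℂ × GL ι ℂ) :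
    ∃ (c : ℂ) (s : Matrix.SpecialLinearGroup ι ℂ × Matrix.SpecialLinearGroup ι ℂ ×
        Matrix.SpecialLinearGroup ι ℂ), c ≠ 0 ∧ ∀ w : ι → ι → ι → ℂ,
      actTensor (g.1 : Matrix ι ι ℂ) (g.2.1 : Matrix ι ι ℂ) (g.2.2 : Matrix ι ι ℂ) w =
        c • actTensor (s.1 : Matrix ι ι ℂ) (s.2.1 : Matrix ι ι ℂ) (s.2.2 : Matrix ι ι ℂ) w := by
  obtain ⟨α, s₁, hα, h₁⟩ := exists_eq_smul_sl g.1
  obtain ⟨β, s₂, hβ, h₂⟩ := exists_eq_smul_sl g.2.1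
  obtain ⟨γ, s₃, hγ, h₃⟩ := exists_eq_smul_sl g.2.2
  refine ⟨α * β * γ, (s₁, s₂, s₃), mul_ne_zero (mul_ne_zero hα hβ) hγ, fun w => ?_⟩
  rw [h₁, h₂, h₃, actTensor_smul_fst, actTensor_smul_snd, actTensor_smul_thd, smul_smul, smul_smul]

end Action

/-! ## Kempf–Ness rigidity: a degeneration between polystable tensors is an isomorphism -/

section Rigidity

variable {ι : Type*} [Fintype ι] [DecidableEq ι]

/-- **Polystable rigidity.** If `w₀ ⊵ w₁` (orbit-closure degeneration), `w₀` and `w₁` are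
polystable and `w₁ ≠ 0`, then `w₁ = c • (s·w₀)` with `c ≠ 0`, `s ∈ SL³`: the degeneration is an
isomorphism. [cite: KempfNess1979, Thm. 0.2; BurgisserIkenmeyer2017, §4.2 and §5] -/
theorem exists_smul_sl3_eq_of_degeneratesTo [Nonempty ι] {w₀ w₁ : ι → ι → ι → ℂ}
    (hdeg : TensorDegeneratesTo w₀ w₁) (h₀ : IsPolystableTensor w₀) (h₁ : IsPolystableTensor w₁)
    (hw₁ : w₁ ≠ 0) :
    ∃ (c : ℂ) (s : Matrix.SpecialLinearGroup ι ℂ × Matrix.SpecialLinearGroup ι ℂ ×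
        Matrix.SpecialLinearGroup ι ℂ), c ≠ 0 ∧
      w₁ = c • actTensor (s.1 : Matrix ι ι ℂ) (s.2.1 : Matrix ι ι ℂ) (s.2.2 : Matrix ι ι ℂ) w₀ := by
  classical
  -- the closed orbit `O = SL³·w₀`
  set O : Set (ι → ι → ι → ℂ) := Set.range fun g :
      Matrix.SpecialLinearGroup ι ℂ × Matrix.SpecialLinearGroup ι ℂ × Matrix.SpecialLinearGroup ι ℂ =>
    actTensor (g.1 : Matrix ι ι ℂ) (g.2.1 : Matrix ι ι ℂ) (g.2.2 : Matrix ι ι ℂ) w₀ with hO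
  have hOcl : IsClosed O := h₀
  have hw₀ : w₀ ≠ 0 := by
    rintro rfl
    exact hw₁ (TensorDegeneratesTo.eq_zero_of_zero hdeg)
  have h0O : (0 : ι → ι → ι → ℂ) ∉ O := by
    rintro ⟨g, hg⟩
    have hg' : actTensor (g.1 : Matrix ι ι ℂ) (g.2.1 : Matrix ι ι ℂ) (g.2.2 : Matrix ι ι ℂ) w₀ = 0 :=
      hg
    apply hw₀
    have key : actTensor ((g.1 : Matrix ι ι ℂ)⁻¹) ((g.2.1 : Matrix ι ι ℂ)⁻¹)
        ((g.2.2 : Matrix ι ι ℂ)⁻¹)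
        (actTensor (g.1 : Matrix ι ι ℂ) (g.2.1 : Matrix ι ι ℂ) (g.2.2 : Matrix ι ι ℂ) w₀) = w₀ := by
      rw [actTensor_actTensor, sl_inv_mul, sl_inv_mul, sl_inv_mul, actTensor_one]
    rw [← key, hg', actTensor_zero]
  -- an orbit sequence `x k = g_k·w₀ → w₁`, written `x k = c k • (s k·w₀)` with `s k ∈ SL³`
  obtain ⟨x, hxmem, hxlim⟩ := mem_closure_iff_seq_limit.mp hdeg
  choose g hg using hxmem
  choose c s hc0 hcs using fun k => exists_eq_smul_sl3 (g k)
  have hxk : ∀ k, x k = c k • actTensor ((s k).1 : Matrix ι ι ℂ) ((s k).2.1 : Matrix ι ι ℂ)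
      ((s k).2.2 : Matrix ι ι ℂ) w₀ := fun k => by
    rw [← hcs k]
    exact (hg k).symm
  have hyO : ∀ k, actTensor ((s k).1 : Matrix ι ι ℂ) ((s k).2.1 : Matrix ι ι ℂ)
      ((s k).2.2 : Matrix ι ι ℂ) w₀ ∈ O := fun k => ⟨s k, rfl⟩
  -- `O` stays a positive distance `δ` away from `0`, so the scalars `c k` are bounded
  have hOne : O.Nonempty := ⟨_, hyO 0⟩
  have hδ : 0 < Metric.infDist (0 : ι → ι → ι → ℂ) O :=
    (hOcl.notMem_iff_infDist_pos hOne).mp h0O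
  obtain ⟨M, hM⟩ := (Metric.isBounded_range_of_tendsto x hxlim).exists_norm_le
  have hcb : ∀ k, ‖c k‖ ≤ M / Metric.infDist (0 : ι → ι → ι → ℂ) O := by
    intro k
    rw [le_div_iff₀ hδ]
    have h1 : Metric.infDist (0 : ι → ι → ι → ℂ) O ≤ ‖actTensor ((s k).1 : Matrix ι ι ℂ)
        ((s k).2.1 : Matrix ι ι ℂ) ((s k).2.2 : Matrix ι ι ℂ) w₀‖ := by
      have := Metric.infDist_le_dist_of_mem (x := (0 : ι → ι → ι → ℂ)) (hyO k)
      rwa [dist_comm, dist_zero_right] at this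
    have h2 : ‖x k‖ ≤ M := hM _ ⟨k, rfl⟩
    calc ‖c k‖ * Metric.infDist (0 : ι → ι → ι → ℂ) O
        ≤ ‖c k‖ * ‖actTensor ((s k).1 : Matrix ι ι ℂ) ((s k).2.1 : Matrix ι ι ℂ)
            ((s k).2.2 : Matrix ι ι ℂ) w₀‖ := mul_le_mul_of_nonneg_left h1 (norm_nonneg _)
      _ = ‖x k‖ := by rw [hxk k, norm_smul]
      _ ≤ M := h2
  -- Bolzano–Weierstrass for the scalars
  obtain ⟨a, -, φ, hφ, hca⟩ := tendsto_subseq_of_bounded (Metric.isBounded_closedBall)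
    (fun k => mem_closedBall_zero_iff.mpr (hcb k))
  have hxφ : Tendsto (x ∘ φ) atTop (𝓝 w₁) := hxlim.comp hφ.tendsto_atTop
  by_cases ha : a = 0
  · -- `a = 0` is impossible: an `SL³`-invariant with `q(w₁) = 1`, `q(0) = 0` is constant in `k`
    exfalso
    have hca0 : Tendsto (c ∘ φ) atTop (𝓝 0) := ha ▸ hca
    have hBcl : ∃ T : Set (MvPolynomial (ι × ι × ι) ℂ), ∀ w : ι → ι → ι → ℂ,
        w ∈ ({0} : Set (ι → ι → ι → ℂ)) ↔
          ∀ Φ ∈ T, MvPolynomial.aeval (tensorPt w) Φ = 0 := by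
      refine ⟨Set.range MvPolynomial.X, fun w => ⟨?_, ?_⟩⟩
      · rintro (rfl : w = 0) Φ ⟨p, rfl⟩
        rw [MvPolynomial.aeval_X]
        rfl
      · intro h
        show w = 0
        funext i j l
        have := h (MvPolynomial.X (i, j, l)) ⟨(i, j, l), rfl⟩
        rwa [MvPolynomial.aeval_X] at this
    have hBst : ∀ (g' : Matrix.SpecialLinearGroup ι ℂ × Matrix.SpecialLinearGroup ι ℂ ×
        Matrix.SpecialLinearGroup ι ℂ) (w : ι → ι → ι → ℂ), w ∈ ({0} : Set (ι → ι → ι → ℂ)) →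
        actTensor (g'.1 : Matrix ι ι ℂ) (g'.2.1 : Matrix ι ι ℂ) (g'.2.2 : Matrix ι ι ℂ) w ∈
          ({0} : Set (ι → ι → ι → ℂ)) := by
      intro g' w hw
      rw [Set.mem_singleton_iff] at hw ⊢
      rw [hw, actTensor_zero]
    obtain ⟨q, hqinv, hq1, hq0⟩ := h₁.exists_isSL3Invariant_eq_one_of_forall_eq_zero hBcl hBst
      (fun h => hw₁ (Set.mem_singleton_iff.mp h))
    set F : (ι → ι → ι → ℂ) → ℂ := fun v => MvPolynomial.aeval (tensorPt v) q with hF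
    have hFc : Continuous F := by
      have : F = fun v => MvPolynomial.eval (tensorPt v) q := by
        funext v
        rfl
      rw [this]
      exact (MvPolynomial.continuous_eval q).comp continuous_tensorPt
    have hF0 : F 0 = 0 := hq0 0 (Set.mem_singleton _)
    have hF1 : F w₁ = 1 := hq1
    have hFx : ∀ k, F (x k) = F (c k • w₀) := by
      intro k
      simp only [hF]
      rw [hxk k, ← actTensor_smul_arg]
      exact hqinv (s k).1 (s k).2.1 (s k).2.2 (c k • w₀)
    have lim1 : Tendsto (fun k => F (x (φ k))) atTop (𝓝 1) := by
      rw [← hF1]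
      exact (hFc.tendsto w₁).comp hxφ
    have lim0 : Tendsto (fun k => F (x (φ k))) atTop (𝓝 0) := by
      have hc0' : Tendsto (fun k => (c ∘ φ) k • w₀) atTop (𝓝 ((0 : ℂ) • w₀)) :=
        hca0.smul tendsto_const_nhds
      rw [zero_smul] at hc0'
      have h := (hFc.tendsto 0).comp hc0'
      rw [hF0] at h
      refine h.congr fun k => ?_
      simp only [Function.comp_apply]
      exact (hFx (φ k)).symm
    exact one_ne_zero (tendsto_nhds_unique lim1 lim0)
  · -- `a ≠ 0`: the `SL³`-parts converge, inside the CLOSED orbit `O`, to `a⁻¹ • w₁`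
    have hy : Tendsto (fun k => actTensor ((s (φ k)).1 : Matrix ι ι ℂ)
        ((s (φ k)).2.1 : Matrix ι ι ℂ) ((s (φ k)).2.2 : Matrix ι ι ℂ) w₀) atTop
        (𝓝 (a⁻¹ • w₁)) := by
      have h := (hca.inv₀ ha).smul hxφ
      refine h.congr fun k => ?_
      simp only [Function.comp_apply]
      rw [hxk (φ k), inv_smul_smul₀ (hc0 (φ k))]
    have hmem : a⁻¹ • w₁ ∈ O :=
      hOcl.mem_of_tendsto hy (Eventually.of_forall fun k => hyO (φ k))
    obtain ⟨s', hs'⟩ := hmem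
    refine ⟨a, s', ha, ?_⟩
    have hs'' : actTensor (s'.1 : Matrix ι ι ℂ) (s'.2.1 : Matrix ι ι ℂ) (s'.2.2 : Matrix ι ι ℂ) w₀ =
        a⁻¹ • w₁ := hs'
    rw [hs'', smul_inv_smul₀ ha]

/-- **A degeneration between polystable tensors is an isomorphism**: restriction both ways.
[cite: KempfNess1979, Thm. 0.2; BurgisserIkenmeyer2017, §4.2] -/
theorem restrictsTo_and_of_degeneratesTo [Nonempty ι] {w₀ w₁ : ι → ι → ι → ℂ}
    (hdeg : TensorDegeneratesTo w₀ w₁) (h₀ : IsPolystableTensor w₀) (h₁ : IsPolystableTensor w₁)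
    (hw₁ : w₁ ≠ 0) : TensorRestrictsTo w₀ w₁ ∧ TensorRestrictsTo w₁ w₀ := by
  obtain ⟨c, g, hc, hw⟩ := exists_smul_sl3_eq_of_degeneratesTo hdeg h₀ h₁ hw₁
  constructor
  · rw [hw, ← actTensor_smul_fst]
    exact tensorRestrictsTo_actTensor _ _ _ _
  · have key : actTensor (c⁻¹ • (g.1 : Matrix ι ι ℂ)⁻¹) ((g.2.1 : Matrix ι ι ℂ)⁻¹)
        ((g.2.2 : Matrix ι ι ℂ)⁻¹) w₁ = w₀ := by
      rw [hw, actTensor_smul_arg, actTensor_smul_fst, actTensor_actTensor, sl_inv_mul, sl_inv_mul,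
        sl_inv_mul, actTensor_one, smul_smul, mul_inv_cancel₀ hc, one_smul]
    rw [← key]
    exact tensorRestrictsTo_actTensor _ _ _ _

/-- **Degeneration-rigidity of critical tensors**: two polystable tensors that are not
restrictions of one another do not degenerate to one another. [cite: KempfNess1979, Thm. 0.2] -/
theorem not_degeneratesTo_of_polystable [Nonempty ι] {w₀ w₁ : ι → ι → ι → ℂ}
    (h₀ : IsPolystableTensor w₀) (h₁ : IsPolystableTensor w₁) (hw₁ : w₁ ≠ 0)
    (hnr : ¬ TensorRestrictsTo w₀ w₁) : ¬ TensorDegeneratesTo w₀ w₁ := fun hdeg =>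
  hnr (restrictsTo_and_of_degeneratesTo hdeg h₀ h₁ hw₁).1

end Rigidity

end Summit.MatrixMultiplication.MatrixMultiplication.Theorems.OutsiderSandwichPolystableRigidity

end
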